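import Summits.ABC.StewartYu.PadicG3CountMidx
import Summits.ABC.StewartYu.PadicG3StartR
import HarnessLib

/-!
# Cell abc-stewartyu, crux `Y07Odd` (stmt-ABC-19658): the START count in p2's RESTRICTED-JET form
# `Icc(−X₀, X₀) ×ˢ tauSetR n j₀ T₀` (`IneqPackR`, p497974) — the hB1 conjunct BY NAME, both branches

`Summits/ABC/StewartYu/PadicG3CountR.lean` — cell `abc-stewartyu` (HOME `run/shared/lean/pub/abc-stewartyu/`),
route `PadicPrimesKummerThird`, crux `Y07Odd` (stmt-ABC-19658); seat lp-1 (g3), planner g9 04:57:33Z seam (i).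
Theorems only.

p2's repair of the START count (R21-a) keeps the jet set but restricts it to the pivot-free jets
`tauSetR n j₀ T = {τ ∈ tauSet n T | τ.2 j₀ = 0}` with `#tauSetR n j₀ T ≤ C(T+n−1, n)` (`card_tauSetR_le_choose`,
`PadicG3StartR` p497460) — the same binomial as the multi-index form `midx` of `PadicG3CountMidx`.  Hence the first
conjunct of `IneqPackR S Sc` follows from p1's `siegel_countV'` (m = 0) / the v1 `siegel_count₁` (any m) at
`M′ := T₀ − 1`:
* `startCountRV` / `startCountR1` — for `X₀ ≤ XsV 0` (resp. `≤ X`) and `T₀ ≤ MordV 0 0 + (n+1)(ŜG+1) + 1`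
  (resp. `Mord 0 0 + (n+1)(Ŝ+1) + 1`), class factor `(p−1)·p^m = K` (`K₀ = p − 1`);
* `startCountRV_schedV` / `startCountR1_sched1` — at `(X₀, T₀) := (NS Sc 0 0, TordS Sc 0 0)` for p2's `P.schedV` /
  `P.sched1` (`TordS_zero_le`), i.e. LITERALLY the left-hand side of `IneqPackR`'s first conjunct, with the unknowns
  counted over the print box `sideV j = ⌊LV/(2Aⱼ)⌋` / `side j = ⌊L/(2Aⱼ)⌋` (R21-d; `= S.sideS Sc j` once the schedule's
  box is `⌊Lbox/(2Aⱼ)⌋`).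

References: Yu. V. Nesterenko, LNM 1819 (2003), Prop. 3.9 (3.48); M. Waldschmidt, Acta Arith. 37 (1980) §3.
-/

noncomputable section

open Finset
open Literature.NumberTheory.Transcendental
open Literature.NumberTheory.Transcendental.CW77.Setup (Tau tauNorm tauSet)

namespace Summit.ABC.StewartYu

namespace G3Setup

variable {p : ℕ} [Fact p.Prime] (S : G3Setup p) (P : PadicG3Par S.n)

/-- `#(Icc(−X,X) ×ˢ tauSetR n j₀ T) ≤ (2X+1)·C((T−1)+n, n)`. [cite: Waldschmidt1980, §3 (3.6)] -/
theorem card_eqsR_le (X T : ℕ) :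
    (Icc (-(X : ℤ)) X ×ˢ tauSetR S.n S.j₀ T).card ≤ (2 * X + 1) * ((T - 1) + S.n).choose S.n := by
  have hn : 1 ≤ S.n := Fin.pos S.j₀
  rw [Finset.card_product, Int.card_Icc]
  have h1 : ((X : ℤ) + 1 - -(X : ℤ)).toNat = 2 * X + 1 := by omega
  rw [h1]
  refine Nat.mul_le_mul_left _ ((card_tauSetR_le_choose hn S.j₀ T).trans ?_)
  exact Nat.choose_le_choose S.n (by omega)

/-- **(B1), restricted-jet form, branch `m = 0` (v2 family)**: for `P.p = p`, `K₀ = p − 1`, `X₀ ≤ XsV 0`,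
`T₀ ≤ MordV 0 0 + (n+1)(ŜG+1) + 1`:
`2·#(Icc(−X₀,X₀) ×ˢ tauSetR n j₀ T₀)·((p−1)·p^m) ≤ (L₀V+1)·∏(2·sideV j+1)`. [cite: Nesterenko2003, Prop 3.9 (3.48)] -/
theorem startCountRV (hPp : P.p = p) (hK₀ : P.K₀ = p - 1) {X₀ T₀ : ℕ} (hX : X₀ ≤ P.XsV 0)
    (hT : T₀ ≤ P.MordV 0 0 + (S.n + 1) * (P.SdG + 1) + 1) :
    2 * (Icc (-(X₀ : ℤ)) X₀ ×ˢ tauSetR S.n S.j₀ T₀).card * ((p - 1) * p ^ P.m) ≤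
      (P.L0V + 1) * ∏ j, (2 * P.sideV j + 1) := by
  have h1 := S.card_eqsR_le X₀ T₀
  have h2 := P.siegel_countV' (M' := T₀ - 1) (by omega)
  rw [P.class_factor_eq_K hPp hK₀]
  calc 2 * (Icc (-(X₀ : ℤ)) X₀ ×ˢ tauSetR S.n S.j₀ T₀).card * P.K
      ≤ 2 * ((2 * X₀ + 1) * ((T₀ - 1) + S.n).choose S.n) * P.K := by gcongr
    _ ≤ 2 * ((2 * P.XsV 0 + 1) * ((T₀ - 1) + S.n).choose S.n) * P.K := by gcongr
    _ = 2 * (2 * P.XsV 0 + 1) * Nat.choose ((T₀ - 1) + S.n) S.n * P.K := by ring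
    _ ≤ _ := h2

/-- **(B1), restricted-jet form, branch `m ≥ 1` (v1 family; any `m`)**: for `P.p = p`, `K₀ = p − 1`, `X₀ ≤ X`,
`T₀ ≤ Mord 0 0 + (n+1)(Ŝ+1) + 1`:
`2·#(Icc(−X₀,X₀) ×ˢ tauSetR n j₀ T₀)·((p−1)·p^m) ≤ (L₀+1)·∏(2·side j+1)`. [cite: Nesterenko2003, Prop 3.9 (3.48)] -/
theorem startCountR1 (hPp : P.p = p) (hK₀ : P.K₀ = p - 1) {X₀ T₀ : ℕ} (hX : X₀ ≤ P.X)
    (hT : T₀ ≤ P.Mord 0 0 + (S.n + 1) * (P.Sdepth + 1) + 1) :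
    2 * (Icc (-(X₀ : ℤ)) X₀ ×ˢ tauSetR S.n S.j₀ T₀).card * ((p - 1) * p ^ P.m) ≤
      (P.L₀ + 1) * ∏ j, (2 * P.side j + 1) := by
  have h1 := S.card_eqsR_le X₀ T₀
  have h2 := P.siegel_count₁ (M' := T₀ - 1) (by omega)
  rw [P.class_factor_eq_K hPp hK₀]
  calc 2 * (Icc (-(X₀ : ℤ)) X₀ ×ˢ tauSetR S.n S.j₀ T₀).card * P.K
      ≤ 2 * ((2 * X₀ + 1) * ((T₀ - 1) + S.n).choose S.n) * P.K := by gcongr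
    _ ≤ 2 * ((2 * P.X + 1) * ((T₀ - 1) + S.n).choose S.n) * P.K := by gcongr
    _ = 2 * (2 * P.X + 1) * Nat.choose ((T₀ - 1) + S.n) S.n * P.K := by ring
    _ ≤ _ := h2

/-- **The first conjunct of `IneqPackR` at p2's `m = 0` schedule `P.schedV`**, unknowns over the print box
`sideV j = ⌊LV/(2Aⱼ)⌋`. [cite: Nesterenko2003, Prop 3.9 (3.48)] -/
theorem startCountRV_schedV (hPp : P.p = p) (hK₀ : P.K₀ = p - 1) :
    2 * (Icc (-(S.NS P.schedV 0 0 : ℤ)) (S.NS P.schedV 0 0) ×ˢ tauSetR S.n S.j₀ (S.TordS P.schedV 0 0)).card *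
        ((p - 1) * p ^ P.schedV.m) ≤ (P.L0V + 1) * ∏ j, (2 * P.sideV j + 1) := by
  have hT := S.TordS_zero_le P.schedV
  rw [S.NS_zero_zero]
  exact S.startCountRV P hPp hK₀ le_rfl (by exact le_trans hT (Nat.le_succ _))

/-- **The first conjunct of `IneqPackR` at p2's `m ≥ 1` schedule `P.sched1`** (no hypothesis on `m`), unknowns over
the print box `side j = ⌊L/(2Aⱼ)⌋`. [cite: Nesterenko2003, Prop 3.9 (3.48)] -/
theorem startCountR1_sched1 (hPp : P.p = p) (hK₀ : P.K₀ = p - 1) :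
    2 * (Icc (-(S.NS P.sched1 0 0 : ℤ)) (S.NS P.sched1 0 0) ×ˢ tauSetR S.n S.j₀ (S.TordS P.sched1 0 0)).card *
        ((p - 1) * p ^ P.sched1.m) ≤ (P.L₀ + 1) * ∏ j, (2 * P.side j + 1) := by
  have hT := S.TordS_zero_le P.sched1
  rw [S.NS_zero_zero]
  exact S.startCountR1 P hPp hK₀ P.Xs_zero_le_X (by exact le_trans hT (Nat.le_succ _))

/-- Sc-generic form, `m = 0` branch: any schedule dominated by `schedV` at level `0`. [cite: Nesterenko2003, Prop 3.9 (3.48)] -/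
theorem startCountRV_sched (Sc : G3Sched S.n) (hPp : P.p = p) (hK₀ : P.K₀ = p - 1) (hm : Sc.m = P.m)
    (hXs : Sc.Xs 0 ≤ P.XsV 0) (hMord : Sc.Mord 0 0 ≤ P.MordV 0 0) (hSd : Sc.Sd ≤ P.SdG) :
    2 * (Icc (-(S.NS Sc 0 0 : ℤ)) (S.NS Sc 0 0) ×ˢ tauSetR S.n S.j₀ (S.TordS Sc 0 0)).card * ((p - 1) * p ^ Sc.m) ≤
      (P.L0V + 1) * ∏ j, (2 * P.sideV j + 1) := by
  rw [hm, S.NS_zero_zero]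
  refine S.startCountRV P hPp hK₀ hXs ?_
  have h := S.TordS_zero_le Sc
  have h2 : (S.n + 1) * (Sc.Sd + 1) ≤ (S.n + 1) * (P.SdG + 1) := Nat.mul_le_mul_left _ (by omega)
  omega

/-- Sc-generic form, `m ≥ 1` branch: any schedule dominated by `sched1` at level `0`. [cite: Nesterenko2003, Prop 3.9 (3.48)] -/
theorem startCountR1_sched (Sc : G3Sched S.n) (hPp : P.p = p) (hK₀ : P.K₀ = p - 1) (hm : Sc.m = P.m)
    (hXs : Sc.Xs 0 ≤ P.X) (hMord : Sc.Mord 0 0 ≤ P.Mord 0 0) (hSd : Sc.Sd ≤ P.Sdepth) :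
    2 * (Icc (-(S.NS Sc 0 0 : ℤ)) (S.NS Sc 0 0) ×ˢ tauSetR S.n S.j₀ (S.TordS Sc 0 0)).card * ((p - 1) * p ^ Sc.m) ≤
      (P.L₀ + 1) * ∏ j, (2 * P.side j + 1) := by
  rw [hm, S.NS_zero_zero]
  refine S.startCountR1 P hPp hK₀ hXs ?_
  have h := S.TordS_zero_le Sc
  have h2 : (S.n + 1) * (Sc.Sd + 1) ≤ (S.n + 1) * (P.Sdepth + 1) := Nat.mul_le_mul_left _ (by omega)
  omega

end G3Setup

end Summit.ABC.StewartYu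

end
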